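import Summits.CriticalPhenomena.PercolationContinuityZ3.Theorems.SahiPairwiseTP2LineConnectedDefs
import HarnessLib

/-!
# Line-connectedness cannot be weakened to overlapping coordinate projections

Support file of the Sahi cell (`prim-sahi`, literature seat, generation 46; `--supports stmt-CriticalPhenomena-4575`).

The conjecture of [FallatEtAl2017, §3] — proved as `isLogSupermodular_of_pairwiseTP2_of_isLineConnected'`
(`Theorems/SahiPairwiseTP2LineConnected.lean`) — asks that "the connected components of the support can be joined by
axis-parallel LINES" (formalised as `IsLineConnected`: consecutive support points agree off ONE coordinate).  The
notion it refers to, [Peters2015, Def. 3 (ii)] (stated for two blocks of variables `A`, `B`), joins two components as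
soon as their projections on one block OVERLAP, i.e. as soon as they contain points agreeing in that block.  With three
or more scalar coordinates these readings differ, and the weaker one does NOT suffice, even for sublattice supports:

* `sharpWeight` on `{0,1}³` (as `Fin 3 → Bool`): weight `2` at `000`, `001`, `110` and `1` at `111`, `0` elsewhere.
  Its support `{000, 001, 110, 111}` is a sublattice (`sharpWeight_inf_sup`), its two line-components `{000, 001}` and
  `{110, 111}` have the SAME projection `{0,1}` on the third coordinate (`sharpWeight_proj_overlap`: every support
  point agrees in coordinate `2` with a support point of the other component), it is TP₂ in every pair of variables
  (`isPairwiseTP2_sharpWeight` — all constraints are vacuous or equalities), but it is NOT MTP₂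
  (`not_isLogSupermodular_sharpWeight`: at `x = 001`, `y = 110` one has `μ x μ y = 4 > 2 = μ (x ⊓ y) μ (x ⊔ y)`),
  and accordingly its support is not line-connected (`not_isLineConnected_sharpWeight`).
* Packaged: `exists_pairwiseTP2_sublattice_projOverlap_not_isLogSupermodular`.

So in `isLogSupermodular_of_pairwiseTP2_of_isLineConnected'` the hypothesis "joined through support points,
consecutive ones on a common axis-parallel line" cannot be replaced by "components with a common coordinate value"
(Peters' projection overlap read coordinatewise), and the sublattice property of the support does not help.
(The continuous analogue: density `1` on `(0,1)³` and `e^{-x₃}` on `(2,3)² × (0,1)` — pairwise TP₂ at every pair of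
points, third-coordinate projections equal, not MTP₂.)

References: [FallatEtAl2017] S. Fallat, S. Lauritzen, K. Sadeghi, C. Uhler, N. Wermuth, P. Zwiernik, Total positivity
in Markov structures, Ann. Statist. 45 (2017) 1152–1184, §3.  [Peters2015] J. Peters, On the intersection property of
conditional independence and its application to causal discovery, J. Causal Inference 3 (2015) 97–108, Def. 3.
-/

namespace Summit.CriticalPhenomena.PercolationContinuityZ3.Theorems.PairwiseTP2LineConnected

open Function Relation
open Literature.Probability.LatticeModels.FKGEqualityChains (IsLogSupermodular)
open Literature.Probability.LatticeModels.MTP2PairwiseCriterion (IsPairwiseTP2)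

/-- The integer weight table of the counterexample (scaled by `2`): `2` at `000`, `001`, `110`, `1` at `111`, `0`
elsewhere (`Fin 3 → Bool`, `false < true`). [this work] -/
def sharpWeightQ (x : Fin 3 → Bool) : ℕ :=
  if x = ![false, false, false] ∨ x = ![false, false, true] ∨ x = ![true, true, false] then 2
  else if x = ![true, true, true] then 1 else 0

/-- The counterexample kernel (real-valued copy of `sharpWeightQ`; as a probability weight divide by `7`). [this work] -/
noncomputable def sharpWeight (x : Fin 3 → Bool) : ℝ := (sharpWeightQ x : ℝ)

/-- The combinatorial core, checked by `decide` over `ℕ`: every pairwise TP₂ constraint of `sharpWeightQ` holds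
(each is `0 ≤ ·` or an equality). [this work] -/
theorem sharpWeightQ_pairwise : ∀ (x : Fin 3 → Bool) (i j : Fin 3), i ≠ j → ∀ (a a' b b' : Bool), a ≤ a' → b ≤ b' →
    sharpWeightQ (update (update x i a') j b) * sharpWeightQ (update (update x i a) j b') ≤
      sharpWeightQ (update (update x i a) j b) * sharpWeightQ (update (update x i a') j b') := by
  decide

/-- `sharpWeight` is nonnegative. [this work] -/
theorem sharpWeight_nonneg (x : Fin 3 → Bool) : 0 ≤ sharpWeight x := by
  unfold sharpWeight
  exact_mod_cast Nat.zero_le _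

/-- **`sharpWeight` is TP₂ in every pair of variables.** [this work] -/
theorem isPairwiseTP2_sharpWeight : IsPairwiseTP2 sharpWeight := by
  intro x i j hij a a' b b' ha hb
  unfold sharpWeight
  exact_mod_cast sharpWeightQ_pairwise x i j hij a a' b b' ha hb

/-- **`sharpWeight` is not MTP₂**: the lattice inequality fails at `x = 001`, `y = 110`. [this work] -/
theorem not_isLogSupermodular_sharpWeight : ¬ IsLogSupermodular sharpWeight := by
  intro h
  have key := h ![false, false, true] ![true, true, false]
  have e1 : ((![false, false, true] : Fin 3 → Bool) ⊓ ![true, true, false]) = ![false, false, false] := by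
    funext k; fin_cases k <;> rfl
  have e2 : ((![false, false, true] : Fin 3 → Bool) ⊔ ![true, true, false]) = ![true, true, true] := by
    funext k; fin_cases k <;> rfl
  have v1 : sharpWeightQ ![false, false, true] = 2 := by decide
  have v2 : sharpWeightQ ![true, true, false] = 2 := by decide
  have v3 : sharpWeightQ ![false, false, false] = 2 := by decide
  have v4 : sharpWeightQ ![true, true, true] = 1 := by decide
  unfold sharpWeight at key
  rw [e1, e2, v1, v2, v3, v4] at key
  norm_num at key

/-- The support of `sharpWeight` is a sublattice of `{0,1}³` (closed under `⊓`, `⊔`). [this work] -/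
theorem sharpWeight_inf_sup : ∀ a b : Fin 3 → Bool, sharpWeightQ a ≠ 0 → sharpWeightQ b ≠ 0 →
    sharpWeightQ (a ⊓ b) ≠ 0 ∧ sharpWeightQ (a ⊔ b) ≠ 0 := by
  decide

/-- The two line-components of the support have the same projection on coordinate `2`: every support point agrees in
coordinate `2` with a support point lying in the other component (i.e. differing from it in coordinate `0`) — Peters'
"overlapping projections", read coordinatewise. [this work] -/
theorem sharpWeight_proj_overlap : ∀ a : Fin 3 → Bool, sharpWeightQ a ≠ 0 →
    ∃ b : Fin 3 → Bool, sharpWeightQ b ≠ 0 ∧ b 0 ≠ a 0 ∧ b 2 = a 2 := by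
  decide

/-- Invariant for the non-line-connectedness: a line step inside the support never changes coordinate `0`
(two support points agreeing off one coordinate lie in the same block). [this work] -/
theorem sharpWeight_lineStep : ∀ a b : Fin 3 → Bool, sharpWeightQ a ≠ 0 → sharpWeightQ b ≠ 0 →
    ∀ i : Fin 3, (∀ j, j ≠ i → a j = b j) → a 0 = b 0 := by
  decide

/-- The support of `sharpWeight`, as a set. [this work] -/
theorem mem_support_sharpWeight_iff (z : Fin 3 → Bool) : z ∈ {z | sharpWeight z ≠ 0} ↔ sharpWeightQ z ≠ 0 := by
  simp [sharpWeight]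

/-- **The support of `sharpWeight` is not line-connected** (no chain of support points, consecutive ones on a common
axis-parallel line, joins `001` to `110`: coordinate `0` is invariant along such chains). [this work] -/
theorem not_isLineConnected_sharpWeight : ¬ IsLineConnected {z | sharpWeight z ≠ 0} := by
  intro h
  have hx : (![false, false, true] : Fin 3 → Bool) ∈ {z | sharpWeight z ≠ 0} :=
    (mem_support_sharpWeight_iff _).2 (by decide)
  have hy : (![true, true, false] : Fin 3 → Bool) ∈ {z | sharpWeight z ≠ 0} :=
    (mem_support_sharpWeight_iff _).2 (by decide)
  -- coordinate `0` is constant along `LineAdj`-chains inside the support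
  have inv : ∀ {u v : Fin 3 → Bool}, ReflTransGen (LineAdj {z | sharpWeight z ≠ 0}) u v → u 0 = v 0 := by
    intro u v huv
    induction huv with
    | refl => rfl
    | tail _ hbc ih =>
      obtain ⟨hb, hc, i, hi⟩ := hbc
      exact ih.trans (sharpWeight_lineStep _ _ ((mem_support_sharpWeight_iff _).1 hb)
        ((mem_support_sharpWeight_iff _).1 hc) i hi)
  have := inv (h _ hx _ hy)
  simp at this

/-- **Sharpness of the line-connectedness hypothesis.**  There is a nonnegative kernel on `{0,1}³` whose support is a
sublattice whose line-components share all their values of one coordinate (so they are "coordinate-wise connected" in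
the projection sense of [Peters2015, Def. 3 (ii)] read coordinatewise), which is TP₂ in every pair of variables, and
which is nevertheless not MTP₂ — its support is not line-connected in the sense of [FallatEtAl2017, §3] /
`IsLineConnected`. [this work] -/
theorem exists_pairwiseTP2_sublattice_projOverlap_not_isLogSupermodular :
    ∃ μ : (Fin 3 → Bool) → ℝ, (∀ x, 0 ≤ μ x) ∧ IsPairwiseTP2 μ ∧
      (∀ a b, μ a ≠ 0 → μ b ≠ 0 → μ (a ⊓ b) ≠ 0 ∧ μ (a ⊔ b) ≠ 0) ∧
      (∀ a, μ a ≠ 0 → ∃ b, μ b ≠ 0 ∧ b 0 ≠ a 0 ∧ b 2 = a 2) ∧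
      ¬ IsLineConnected {z | μ z ≠ 0} ∧ ¬ IsLogSupermodular μ := by
  refine ⟨sharpWeight, sharpWeight_nonneg, isPairwiseTP2_sharpWeight, ?_, ?_, not_isLineConnected_sharpWeight,
    not_isLogSupermodular_sharpWeight⟩
  · intro a b ha hb
    have ha' : sharpWeightQ a ≠ 0 := (mem_support_sharpWeight_iff a).1 ha
    have hb' : sharpWeightQ b ≠ 0 := (mem_support_sharpWeight_iff b).1 hb
    exact ⟨(mem_support_sharpWeight_iff _).2 (sharpWeight_inf_sup a b ha' hb').1,
      (mem_support_sharpWeight_iff _).2 (sharpWeight_inf_sup a b ha' hb').2⟩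
  · intro a ha
    obtain ⟨b, hb, h0, h2⟩ := sharpWeight_proj_overlap a ((mem_support_sharpWeight_iff a).1 ha)
    exact ⟨b, (mem_support_sharpWeight_iff b).2 hb, h0, h2⟩

end Summit.CriticalPhenomena.PercolationContinuityZ3.Theorems.PairwiseTP2LineConnected
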